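import Summits.KontsevichZagierPeriods.KontsevichZagierPeriods.Theorems.SymplecticScissorsRealOnePeriodRelationsStubFormReductionPAux4

/-!
# Crux `RealOnePeriodRelations` (stmt-KontsevichZagierPeriods-10042), line `nash-retraction-thin-strip`, reshape 10:
# de Rham reduction on the torsion-punctured curve `C_T` — the stub `stub_formReductionP`

Last of five files.  `ω = ω₀ dx + ω₁ dy + ω₂ dw ≡ (ω₀ y + ½ ω₁ f′ − ω₂ w² ∏′ y) θ₀^C` (rules (dx), (b), (w) of
file I); `Q θ₀^C` is reducible for every `Q ∈ ℚ̄[x, y, w]` monomial by monomial: `y^{2m} = f^m` on `C_T`, resp.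
`y^{2m+1} θ₀^C ≡ y^{2m} dx`, and `xⁱ wᵏ f^m` lies in the partial-fraction span of file IV, whose members give
reducible `P θ₀^C`, `P dx` (files II, III).  Hence `H¹_dR(C_T)` is spanned by `θ₀, θ₁ = x θ₀`, the
`dx/(x − t)` and the third-kind `ξ_t = dx/((x − t) y)`, `t ∈ T`.
[cite: HuberWustholz2022, §3.3.1, §13.2]
-/

noncomputable section

open scoped BigOperators Topology PeriodPair
open Set Filter MvPolynomial Complex
open Literature.NumberTheory.Transcendental Literature.NumberTheory.Transcendental.CurvePeriods
open Literature.NumberTheory.Transcendental.CurvePeriods.Ell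

namespace Summit.KontsevichZagierPeriods.SymplecticScissors.RealOnePeriodRelations

namespace TorsionLayer

variable {L : PeriodPair} {T : Finset ℂ}

set_option quotPrecheck false in
/-- `FRed[L, T] ω`: the polynomial 1-form `ω` on `C_T` is `a θ₀ + b θ₁ + Σ e_t dx/(x − t) + Σ o_t ξ_t + dF + ν`
with algebraic data and `ν` over `ℚ̄` vanishing on `C_T` (the conclusion of `stub_formReductionP`). -/
local notation3 (prettyPrint := false) "FRed[" L' ", " T' "] " ω:arg =>
  (∃ (a b : ℂ) (e o : ℂ → ℂ) (F : MvPolynomial (Fin 3) ℂ) (ν : Fin 3 → MvPolynomial (Fin 3) ℂ),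
    IsAlgebraic ℚ a ∧ IsAlgebraic ℚ b ∧ (∀ t ∈ T', IsAlgebraic ℚ (e t)) ∧ (∀ t ∈ T', IsAlgebraic ℚ (o t)) ∧
    HasAlgCoeffs F ∧ (∀ i, HasAlgCoeffs (ν i)) ∧ VanishesOn (curveP L' T') ν ∧
    ω = a • Theta0 L' + b • Theta1 L' + ∑ t ∈ T', e t • dlogV T' t + ∑ t ∈ T', o t • Xi L' T' t + formD F + ν)

/-! ## The reduction of polynomial 1-forms on `C_T` -/

section Main

/-- **`(c xⁱ yʲ wᵏ) θ₀^C` is reducible**: `y² = f` on `C_T` (even `j`), resp. `y θ₀^C = dx` (odd `j`), then partial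
fractions. [folklore] -/
theorem fred_monomial_smul_Theta0 (h₂ : IsAlgebraic ℚ L.g₂) (h₃ : IsAlgebraic ℚ L.g₃) (hT : ∀ b ∈ T, IsAlgebraic ℚ b)
    (d : Fin 3 →₀ ℕ) {c : ℂ} (hc : IsAlgebraic ℚ c) : FRed[L, T] ((monomial d c) • Theta0 L) := by
  have hm : (monomial d c : MvPolynomial (Fin 3) ℂ) = C c * (X 0 ^ (d 0) * X 1 ^ (d 1) * X 2 ^ (d 2)) := by
    rw [monomial_eq, Finsupp.prod_pow, Fin.prod_univ_three]
  rw [hm, C_mul_smul_form]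
  refine fred_smul hc ?_
  rcases Nat.even_or_odd (d 1) with ⟨m, hm1⟩ | ⟨m, hm1⟩
  · -- `j = 2m`: `xⁱ y^{2m} wᵏ = xⁱ wᵏ fᵐ` on `C_T`
    have hmem := X_pow_mul_X_pow_mul_fPoly3_pow_mem_pfracSet (L := L) h₂ h₃ hT (d 0) (d 2) m
    refine fred_smul_Theta0_congr h₂ h₃ ((((hasAlgCoeffs_X 0).pow _).mul ((hasAlgCoeffs_X 1).pow _)).mul
      ((hasAlgCoeffs_X 2).pow _)) (hasAlgCoeffs_of_mem_pfracSet hT hmem) (fun p hp => ?_)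
      (fred_smul_Theta0_of_mem_pfracSet h₂ h₃ hT hmem)
    have hcub := ((mem_points_curveP_iff L T p).1 hp).1
    simp only [map_mul, map_pow, eval_X, eval_fPoly3, hm1]
    rw [← two_mul, pow_mul, hcub]
    ring
  · -- `j = 2m + 1`: `xⁱ y^{2m+1} wᵏ θ₀^C ≡ xⁱ y^{2m} wᵏ dx = xⁱ wᵏ fᵐ dx`
    have hmem := X_pow_mul_X_pow_mul_fPoly3_pow_mem_pfracSet (L := L) h₂ h₃ hT (d 0) (d 2) m
    have hQ : HasAlgCoeffs (X 0 ^ d 0 * X 1 ^ (2 * m) * X 2 ^ d 2 : MvPolynomial (Fin 3) ℂ) :=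
      (((hasAlgCoeffs_X 0).pow _).mul ((hasAlgCoeffs_X 1).pow _)).mul ((hasAlgCoeffs_X 2).pow _)
    have e : (X 0 ^ d 0 * X 1 ^ d 1 * X 2 ^ d 2 : MvPolynomial (Fin 3) ℂ) =
        (X 0 ^ d 0 * X 1 ^ (2 * m) * X 2 ^ d 2) * X 1 := by
      rw [hm1]
      ring
    rw [e]
    refine fred_congr (hasAlgCoeffs_smul_form (hQ.mul (hasAlgCoeffs_X 1)) (hasAlgCoeffs_Theta0 L h₂ h₃))
      (hasAlgCoeffs_vec3 hQ hasAlgCoeffs_zero hasAlgCoeffs_zero) ?_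
      (fred_dx_congr hQ (hasAlgCoeffs_of_mem_pfracSet hT hmem) (fun p hp => ?_)
        (fred_dx_of_mem_pfracSet h₂ h₃ hT hmem))
    · have h := vanishesOn_neg (vanishesOn_rule_dx L T (X 0 ^ d 0 * X 1 ^ (2 * m) * X 2 ^ d 2))
      rwa [neg_sub] at h
    · have hcub := ((mem_points_curveP_iff L T p).1 hp).1
      simp only [map_mul, map_pow, eval_X, eval_fPoly3]
      rw [pow_mul, hcub]
      ring

/-- **`Q θ₀^C` is reducible for every `Q ∈ ℚ̄[x, y, w]`.** [folklore] -/
theorem fred_smul_Theta0 (h₂ : IsAlgebraic ℚ L.g₂) (h₃ : IsAlgebraic ℚ L.g₃) (hT : ∀ b ∈ T, IsAlgebraic ℚ b)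
    {Q : MvPolynomial (Fin 3) ℂ} (hQ : HasAlgCoeffs Q) : FRed[L, T] (Q • Theta0 L) := by
  classical
  rw [as_sum Q, Finset.sum_smul]
  exact fred_sum _ _ fun d _ => fred_monomial_smul_Theta0 h₂ h₃ hT d (hQ d)

/-- **de Rham reduction on `C_T`**: every polynomial 1-form over `ℚ̄` on the torsion-punctured Weierstrass curve
`C_T = {y² = f(x), w ∏_{t∈T}(x − t) = 1}` is `a θ₀ + b θ₁ + Σ_{t∈T} e_t dx/(x − t) + Σ_{t∈T} o_t dx/((x − t) y) + dF + ν`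
with algebraic scalars, `F ∈ ℚ̄[x, y, w]` and `ν` over `ℚ̄` vanishing on `C_T`: `dw ≡ −w² ∂ₓ∏ dx`, `dy ≡ ½ f′ θ₀`,
`dx ≡ y θ₀`, so `ω ≡ Q θ₀`; then `y² = f`, partial fractions in `x, w` over `ℚ̄`, the reduction of `xᵐ θ₀` on `E_L`
(`Weier.exists_reduction`) pulled back along `ι`, and the pole-order reduction `d(y (x − t)^{−j})`.
[cite: HuberWustholz2022, §3.3.1, §13.2] -/
theorem stub_formReductionP (L : PeriodPair) (h₂ : IsAlgebraic ℚ L.g₂) (h₃ : IsAlgebraic ℚ L.g₃)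
    (T : Finset ℂ) (hT : ∀ a ∈ T, IsAlgebraic ℚ a)
    (ω : Fin 3 → MvPolynomial (Fin 3) ℂ) (hω : ∀ i, HasAlgCoeffs (ω i)) :
    ∃ (a b : ℂ) (e o : ℂ → ℂ) (F : MvPolynomial (Fin 3) ℂ) (ν : Fin 3 → MvPolynomial (Fin 3) ℂ),
      IsAlgebraic ℚ a ∧ IsAlgebraic ℚ b ∧ (∀ t ∈ T, IsAlgebraic ℚ (e t)) ∧ (∀ t ∈ T, IsAlgebraic ℚ (o t)) ∧
      HasAlgCoeffs F ∧ (∀ i, HasAlgCoeffs (ν i)) ∧ VanishesOn (curveP L T) ν ∧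
      ω = a • Theta0 L + b • Theta1 L + ∑ t ∈ T, e t • dlogV T t + ∑ t ∈ T, o t • Xi L T t + formD F + ν := by
  have hΘ := hasAlgCoeffs_Theta0 L h₂ h₃
  have hP' : HasAlgCoeffs (pderiv 0 (prodP T)) := (hasAlgCoeffs_prodP hT).pderiv 0
  have hf' : HasAlgCoeffs (C (1 / 2) * pderiv 0 (fPoly3 L)) :=
    (hasAlgCoeffs_C (by rw [one_div]; exact (isAlgebraic_nat 2).inv)).mul ((hasAlgCoeffs_fPoly3 L h₂ h₃).pderiv 0)
  have hW : HasAlgCoeffs (ω 2 * X 2 ^ 2 * pderiv 0 (prodP T)) := ((hω 2).mul ((hasAlgCoeffs_X 2).pow 2)).mul hP'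
  have h0 : FRed[L, T] (![ω 0, 0, 0] : Fin 3 → MvPolynomial (Fin 3) ℂ) :=
    fred_congr (hasAlgCoeffs_vec3 (hω 0) hasAlgCoeffs_zero hasAlgCoeffs_zero)
      (hasAlgCoeffs_smul_form ((hω 0).mul (hasAlgCoeffs_X 1)) hΘ) (vanishesOn_rule_dx L T (ω 0))
      (fred_smul_Theta0 h₂ h₃ hT ((hω 0).mul (hasAlgCoeffs_X 1)))
  have h1 : FRed[L, T] (![0, ω 1, 0] : Fin 3 → MvPolynomial (Fin 3) ℂ) :=
    fred_congr (hasAlgCoeffs_vec3 hasAlgCoeffs_zero (hω 1) hasAlgCoeffs_zero)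
      (hasAlgCoeffs_smul_form ((hω 1).mul hf') hΘ) (vanishesOn_rule_b L T (ω 1))
      (fred_smul_Theta0 h₂ h₃ hT ((hω 1).mul hf'))
  have h2 : FRed[L, T] (![0, 0, ω 2] : Fin 3 → MvPolynomial (Fin 3) ℂ) := by
    have e : (![0, 0, ω 2] : Fin 3 → MvPolynomial (Fin 3) ℂ) =
        (![ω 2 * X 2 ^ 2 * pderiv 0 (prodP T), 0, ω 2] : Fin 3 → MvPolynomial (Fin 3) ℂ) -
          ![ω 2 * X 2 ^ 2 * pderiv 0 (prodP T), 0, 0] := by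
      rw [funext_iff, Fin.forall_fin_succ, Fin.forall_fin_two, Fin.succ_zero_eq_one, Fin.succ_one_eq_two]
      simp
    rw [e]
    exact fred_sub (fred_vanish (hasAlgCoeffs_vec3 hW hasAlgCoeffs_zero (hω 2)) (vanishesOn_rule_w L T (ω 2)))
      (fred_congr (hasAlgCoeffs_vec3 hW hasAlgCoeffs_zero hasAlgCoeffs_zero)
        (hasAlgCoeffs_smul_form (hW.mul (hasAlgCoeffs_X 1)) hΘ) (vanishesOn_rule_dx L T _)
        (fred_smul_Theta0 h₂ h₃ hT (hW.mul (hasAlgCoeffs_X 1))))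
  have e : ω = (![ω 0, 0, 0] : Fin 3 → MvPolynomial (Fin 3) ℂ) + ![0, ω 1, 0] + ![0, 0, ω 2] := by
    rw [funext_iff, Fin.forall_fin_succ, Fin.forall_fin_two, Fin.succ_zero_eq_one, Fin.succ_one_eq_two]
    simp
  have key := fred_add (fred_add h0 h1) h2
  rw [← e] at key
  exact key

end Main

end TorsionLayer

end Summit.KontsevichZagierPeriods.SymplecticScissors.RealOnePeriodRelations

end
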